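import Literature.Barriers.ValiantsHypothesis.BDGIL24NaturalProofsMainTheoremProofs
import HarnessLib

/-!
# "Every sequence of metapolynomials in a sequence of irreducible representations has the same
# circuit complexity up to quasipolynomial blowup" ([BDGIL24, §1, after Thm. 1.1]) — PROVED
# (`BergEtAl2024.metaVQP_of_mem_irreducible`)

Theorem-only companion of the BDGIL24 cluster (val-lit row vdBDGIL24-A; M. van den Berg,
P. Dutta, F. Gesmundo, C. Ikenmeyer, V. Lysikov, *Algebraic metacomplexity and representation
theory*, arXiv:2411.03444 [BergEtAl2024]). The paper's gloss of Cor. 1.2 (p.5, PDF p.6,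
p0006.txt:L1–L6):

> "In all applications of Theorem 1.1, we will always have that `k` is logarithmic … Open
> Question 2 in [GKSS17] asks: given a sequence of irreducible representations of metapolynomials,
> what is the sequence of metapolynomials in it that has the lowest circuit complexity? Theorem 1.1
> answers this question in a very satisfying way: Every such sequence of metapolynomials has the
> same circuit complexity up to quasipolynomial blowup."

In the tree's currency for "quasipolynomial in `N(n) = C(k(n)+n-1, n)`" — the class `metaVQP kk`
of `BDGIL24IsotypicNaturalProofs.lean` (sequences of format `(δ(n), n, k(n))`, `k` p-bounded in
`n`, `δ` p-bounded in `N`, `cc` quasipolynomially bounded in `N`) — this file proves: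

* `metaVQP_of_forall_mem_span_orbit` — **`metaVQP` is closed under orbit-span replacement**: if
  `(Δ_n) ∈ metaVQP` and each `Δ'_n ∈ span (GL_{k(n)} · Δ_n)`, then `(Δ'_n) ∈ metaVQP` (same format;
  `cc(Δ'_n) ≤ (δ(n) n + 1)^{k(n)²-1} (cc(Δ_n) + 2)` by `affComplexity_le_of_mem_span_orbit'`, which is
  quasipolynomial in `N(n)` by `qp_bookkeeping` — "`k` is logarithmic in `N`"); this is the
  `metaVQP` half of `mem_inter_of_forall_mem_span_orbit`, stated without the vanishing ideal;
* **`metaVQP_of_mem_irreducible`** — for a sequence `W_n` of IRREDUCIBLE `GL_{k(n)}`-stable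
  subspaces of format-`(*, n, k(n))` metapolynomials (irreducible test `GL`-modules in the sense of
  [GKSS17] §4.1, `GKSS2017.IsTestModule`), if SOME nowhere-zero family `(T_n ∈ W_n)` lies in
  `metaVQP`, then EVERY family `(S_n ∈ W_n)` lies in `metaVQP` (`W_n` is the orbit span of `T_n`,
  `le_span_orbit_of_isIrreducible`); `metaVQP_iff_of_mem_irreducible` — two nowhere-zero families of
  the same irreducible modules are simultaneously in `metaVQP` — the printed "same circuit
  complexity up to quasipolynomial blowup", i.e. the answer to [GKSS17] Open Question 2
  (`GKSS2017.easiestComplexity` / `HasTestFamilyIn` are the question's typed schema) in the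
  quasipolynomial regime. (Polynomial blowup — `metaVP` — is NOT claimed: the factor
  `(δn+1)^{k²-1}` is only quasipolynomial in `N`.)

No definitions, no named facts. Honest framing: a statement about the FORM/complexity of
metapolynomials inside irreducible modules; nothing here bears on `VP ≠ VNP`.
-/

noncomputable section

open MvPolynomial

namespace Literature.Barriers.ValiantsHypothesis

namespace BergEtAl2024

open Literature.Computability.AlgebraicComplexity Literature.NumberTheory.DiophantineGeometry

/-- **`metaVQP` is closed under orbit-span replacement**: if `(Δ_n) ∈ metaVQP` (format
`(δ(n), n, k(n))`) and `Δ'_n ∈ span (GL_{k(n)} · Δ_n)` for every `n`, then `(Δ'_n) ∈ metaVQP` with the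
same format — `Δ'_n` is homogeneous of degree `δ(n)` (`isHomogeneous_of_mem_span_orbit`) and
`cc(Δ'_n) ≤ (δ(n) n + 1)^{k(n)²-1} (cc(Δ_n) + 2)` (`affComplexity_le_of_mem_span_orbit'`) is
quasipolynomial in `N(n)` because `k(n)` is logarithmic in `N(n)` (`qp_bookkeeping`).
[cite: BergEtAl2024, §1 (after Thm. 1.1) and §2.5 (proof of Thm. 2.4), p.5 and p.10 (PDF p.6, p.11)] locator: paper:arxiv-2411.03444 p0006.txt:L1–L6; p0012.txt:L1–L12 -/
theorem metaVQP_of_forall_mem_span_orbit {kk : ℕ → ℕ}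
    {Δ Δ' : (n : ℕ) → MvPolynomial (DegIdx (Fin (kk n)) n) ℂ} (hV : Δ ∈ metaVQP kk)
    (hΔ' : ∀ n, Δ' n ∈ Submodule.span ℂ
      (Set.range fun h : GL (Fin (kk n)) ℂ => coordRep (Fin (kk n)) ℂ n h (Δ n))) :
    Δ' ∈ metaVQP kk := by
  obtain ⟨hkk, δ, hhom, hδ, hcc⟩ := hV
  refine ⟨hkk, δ, fun n => isHomogeneous_of_mem_span_orbit (hhom n) (hΔ' n), hδ, ?_⟩
  obtain ⟨c₁, hc₁⟩ := hkk
  obtain ⟨c₂, hc₂⟩ := hδ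
  obtain ⟨a, ha⟩ := hcc
  obtain ⟨A, hA⟩ := qp_bookkeeping c₁ c₂ a
  refine ⟨A, fun n => hA (kk n) n (δ n) (affComplexity (Δ n)) _ (hc₁ n) (hc₂ n) (ha n) ?_⟩
  exact affComplexity_le_of_mem_span_orbit' (hhom n) le_rfl (hΔ' n)

/-- **[BDGIL24]'s answer to [GKSS17] Open Question 2 ("every such sequence of metapolynomials has
the same circuit complexity up to quasipolynomial blowup"), `metaVQP` form.** Let `W_n` be
IRREDUCIBLE `GL_{k(n)}`-stable subspaces of format-`(*, n, k(n))` metapolynomials (irreducible test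
`GL`-modules, [GKSS17] §4.1). If some family `(T_n)` with `0 ≠ T_n ∈ W_n` lies in `metaVQP`, then
every family `(S_n)` with `S_n ∈ W_n` lies in `metaVQP`: `W_n` is the orbit span of `T_n`
(`le_span_orbit_of_isIrreducible`), and `metaVQP` is closed under orbit-span replacement
(`metaVQP_of_forall_mem_span_orbit`; sharp bound `cc(S_n) ≤ (δ(n) n+1)^{k(n)²-1}(cc(T_n)+2)`, cf.
`cor_1_2_sharp`). Polynomial blowup (`metaVP`) is not claimed.
[cite: BergEtAl2024, §1 (after Thm. 1.1; Cor. 1.2), p.5 (PDF p.6)] locator: paper:arxiv-2411.03444 p0006.txt:L1–L10 -/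
theorem metaVQP_of_mem_irreducible {kk : ℕ → ℕ}
    (W : (n : ℕ) → Submodule ℂ (MvPolynomial (DegIdx (Fin (kk n)) n) ℂ))
    (hW : ∀ n (g : GL (Fin (kk n)) ℂ), W n ≤ (W n).comap (coordRep (Fin (kk n)) ℂ n g))
    (hirr : ∀ n, ((coordRep (Fin (kk n)) ℂ n).subrepresentation (W n) (hW n)).IsIrreducible)
    {T S : (n : ℕ) → MvPolynomial (DegIdx (Fin (kk n)) n) ℂ}
    (hT : T ∈ metaVQP kk) (hTW : ∀ n, T n ∈ W n) (hT0 : ∀ n, T n ≠ 0) (hSW : ∀ n, S n ∈ W n) :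
    S ∈ metaVQP kk :=
  metaVQP_of_forall_mem_span_orbit hT fun n =>
    le_span_orbit_of_isIrreducible (W n) (hW n) (hirr n) (hTW n) (hT0 n) (hSW n)

/-- **"The same circuit complexity up to quasipolynomial blowup"**: two nowhere-zero families of
the same sequence of irreducible test `GL`-modules are simultaneously in `metaVQP`.
[cite: BergEtAl2024, §1 (after Thm. 1.1), p.5 (PDF p.6)] locator: paper:arxiv-2411.03444 p0006.txt:L4–L6 -/
theorem metaVQP_iff_of_mem_irreducible {kk : ℕ → ℕ}
    (W : (n : ℕ) → Submodule ℂ (MvPolynomial (DegIdx (Fin (kk n)) n) ℂ))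
    (hW : ∀ n (g : GL (Fin (kk n)) ℂ), W n ≤ (W n).comap (coordRep (Fin (kk n)) ℂ n g))
    (hirr : ∀ n, ((coordRep (Fin (kk n)) ℂ n).subrepresentation (W n) (hW n)).IsIrreducible)
    {T S : (n : ℕ) → MvPolynomial (DegIdx (Fin (kk n)) n) ℂ}
    (hTW : ∀ n, T n ∈ W n) (hT0 : ∀ n, T n ≠ 0) (hSW : ∀ n, S n ∈ W n) (hS0 : ∀ n, S n ≠ 0) :
    T ∈ metaVQP kk ↔ S ∈ metaVQP kk :=
  ⟨fun hT => metaVQP_of_mem_irreducible W hW hirr hT hTW hT0 hSW,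
    fun hS => metaVQP_of_mem_irreducible W hW hirr hS hSW hS0 hTW⟩

/-- The irreducible modules in question are test `GL`-modules in the sense of [GKSS17] §4.1
(`GKSS2017.IsTestModule`): the dictionary to Open Question 2's typed schema
(`GKSS2017.easiestComplexity`, `GKSS2017.HasTestFamilyIn`).
[cite: BergEtAl2024, §1 (after Thm. 1.1), p.5 (PDF p.6)] locator: paper:arxiv-2411.03444 p0006.txt:L1–L6 -/
theorem isTestModule_of_stable {k d : ℕ} (W : Submodule ℂ (MvPolynomial (DegIdx (Fin k) d) ℂ))
    (hW : ∀ g : GL (Fin k) ℂ, W ≤ W.comap (coordRep (Fin k) ℂ d g)) :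
    GKSS2017.IsTestModule (coordRep (Fin k) ℂ d) W :=
  fun g _ hT => hW g hT

end BergEtAl2024

end Literature.Barriers.ValiantsHypothesis
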